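import Mathlib

/-!
# Imbrie (2016), Assumption LLA: the scaling lemma — a shift-0 small-gap law is an all-shifts window law

CITATION HEADER (lean-in-tree rule 2026-08-18). J. Z. Imbrie, *On many-body localization for quantum spin chains*,
J. Stat. Phys. **163** (2016) 998–1048, doi 10.1007/s10955-016-1508-x, arXiv:1403.7837 [ImbrieJSP2016], eq. (1.1) (the box
Hamiltonian is LINEAR in its couplings `h_i, Γ_i, J_i`), p. 1000 (laws with bounded densities supported in `[-1, 1]`, a box
star-shaped about `0`), eq. (1.3) = (5.2) (Assumption LLA(ν, C): a law for the MINIMAL gap, i.e. at shift `0`).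

WHAT IS PROVED (a lemma of the audit cell `pub-imbrie`, LLA.md block WE10; NOT a statement of the paper). Let `μ` be an
additive Haar measure on a finite-dimensional real normed space `E` (dimension `d`), `B ⊆ E` measurable and STAR-SHAPED about
`0`, and `Δ : E → ℝ` measurable and positively homogeneous of degree one (`Δ (c • x) = c * Δ x`, `c > 0`) — e.g. a difference
of two ordered eigenvalues of a matrix family linear in `x` (cf. `EigenvalueScaling`). Write `S t = {x ∈ B | Δ x ≤ t}`. Then
* `smul_subLevel_subset`, `measure_subLevel_scaling`: `(t/t') • S t' ⊆ S t`, hence `(t/t')^d · μ (S t') ≤ μ (S t)` for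
  `0 ≤ t ≤ t'`, `0 < t'` — the function `t ↦ μ (S t) / t^d` is non-increasing;
* `measure_window_le`: `μ {x ∈ B | y < Δ x ≤ y + η} ≤ (d·η/(y+η)) · μ (S (y+η))` (Bernoulli's inequality);
* `measure_window_le_of_shift_zero`: if the SHIFT-0 LAW `μ (S t) ≤ A·t` holds for all `t > 0` (`A < ∞`), then
  `μ {x ∈ B | y < Δ x ≤ y + η} ≤ A · (d·η)` for EVERY `y ≥ 0` — the same linear law at every shift, extra factor `d` only;
* `measure_Icc_window_le_of_shift_zero`: the same for the closed window `y ≤ Δ x ≤ y + η` (`E` nontrivial);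
* `measure_window_le_of_le_smul`: transfer to any measure `P ≤ D • μ` (a law with density `≤ D` supported anywhere):
  `P {x ∈ B | y < Δ x ≤ y + η} ≤ D · A · (d·η)`.
USE IN THE CELL: with the two-site (or m-site) block of the dilute ladder and Lebesgue measure on the thin coupling box, the
shift-0 input is the cell's two-site slab bound (LLA.md O2) and the output is the γ-uniform, log-free level-difference
density bound (S₂-L^∞) (LLA.md WE10 (a)), whence row k = 2 of the dilute ladder. STATUS: pure measure theory; says NOTHING
about whether LLA holds — LLA for γ > 0 remains an OPEN, UNPROVED hypothesis of Thm 1.1. No `sorry`, no new axioms.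
-/

noncomputable section
open _root_.MeasureTheory Set Filter
open scoped ENNReal Topology Pointwise

namespace Literature.MathematicalPhysics.QuantumLattice.Imbrie2016

variable {E : Type*} [NormedAddCommGroup E] [NormedSpace ℝ E] [MeasurableSpace E] [BorelSpace E]
  [FiniteDimensional ℝ E]

/-- [cite: ImbrieJSP2016, p. 1000 (laws supported in `[-1,1]`)] `B` is star-shaped about the origin:
`t • x ∈ B` for `x ∈ B`, `0 ≤ t ≤ 1`. -/
def StarShapedAtZero (B : Set E) : Prop :=
  ∀ x ∈ B, ∀ t : ℝ, 0 ≤ t → t ≤ 1 → t • x ∈ B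

/-- [cite: ImbrieJSP2016, eq. (1.1) (linearity of `H` in the couplings)] positive homogeneity of degree one. -/
def PosHomogeneous (Δ : E → ℝ) : Prop :=
  ∀ (c : ℝ) (x : E), 0 < c → Δ (c • x) = c * Δ x

/-- [cite: ImbrieJSP2016, eq. (1.3) = (5.2)] the sub-level set `{x ∈ B | Δ x ≤ t}` (shift-0 event inside the box). -/
def subLevel (B : Set E) (Δ : E → ℝ) (t : ℝ) : Set E := {x | x ∈ B ∧ Δ x ≤ t}

/-- [cite: ImbrieJSP2016, eq. (1.3) = (5.2)] the shifted window event `{x ∈ B | y < Δ x ≤ y + η}`. -/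
def window (B : Set E) (Δ : E → ℝ) (y η : ℝ) : Set E := {x | x ∈ B ∧ y < Δ x ∧ Δ x ≤ y + η}

omit [MeasurableSpace E] [BorelSpace E] [FiniteDimensional ℝ E] in
/-- [cite: ImbrieJSP2016, eq. (1.1)] a positively homogeneous function vanishes at `0`. -/
theorem PosHomogeneous.map_zero {Δ : E → ℝ} (hΔ : PosHomogeneous Δ) : Δ 0 = 0 := by
  have h := hΔ 2 0 (by norm_num)
  rw [smul_zero] at h
  linarith

omit [MeasurableSpace E] [BorelSpace E] [FiniteDimensional ℝ E] in
/-- [cite: ImbrieJSP2016, eq. (1.1), (1.3)] SCALING OF SUB-LEVEL SETS: for `0 ≤ t ≤ t'`, `0 < t'`,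
`(t/t') • {x ∈ B | Δ x ≤ t'} ⊆ {x ∈ B | Δ x ≤ t}` (star-shapedness of `B` + homogeneity of `Δ`). -/
theorem smul_subLevel_subset {B : Set E} {Δ : E → ℝ} (hB : StarShapedAtZero B)
    (hΔ : PosHomogeneous Δ) {t t' : ℝ} (ht : 0 ≤ t) (ht' : 0 < t') (htt' : t ≤ t') :
    (t / t') • subLevel B Δ t' ⊆ subLevel B Δ t := by
  rintro z ⟨x, ⟨hxB, hxΔ⟩, rfl⟩
  have hc0 : 0 ≤ t / t' := div_nonneg ht ht'.le
  have hc1 : t / t' ≤ 1 := (div_le_one ht').2 htt'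
  refine ⟨hB x hxB _ hc0 hc1, ?_⟩
  rcases eq_or_lt_of_le ht with h0 | hpos
  · subst h0
    show Δ ((0 / t') • x) ≤ 0
    rw [zero_div, zero_smul, hΔ.map_zero]
  · show Δ ((t / t') • x) ≤ t
    rw [hΔ _ x (div_pos hpos ht')]
    calc t / t' * Δ x ≤ t / t' * t' := by gcongr
      _ = t := div_mul_cancel₀ t ht'.ne'

/-- [cite: ImbrieJSP2016, eq. (1.1), (1.3)] MONOTONICITY OF `t ↦ μ {x ∈ B | Δ x ≤ t} / t^d`:
`(t/t')^d · μ (S t') ≤ μ (S t)` for `0 ≤ t ≤ t'`, `0 < t'` (Haar scaling `μ (c • s) = c^d μ s`). -/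
theorem measure_subLevel_scaling (μ : Measure E) [μ.IsAddHaarMeasure] {B : Set E} {Δ : E → ℝ}
    (hB : StarShapedAtZero B) (hΔ : PosHomogeneous Δ) {t t' : ℝ} (ht : 0 ≤ t) (ht' : 0 < t')
    (htt' : t ≤ t') :
    ENNReal.ofReal ((t / t') ^ Module.finrank ℝ E) * μ (subLevel B Δ t') ≤ μ (subLevel B Δ t) := by
  rw [← Measure.addHaar_smul_of_nonneg μ (div_nonneg ht ht'.le)]
  exact measure_mono (smul_subLevel_subset hB hΔ ht ht' htt')

omit [NormedAddCommGroup E] [NormedSpace ℝ E] [BorelSpace E] [FiniteDimensional ℝ E] in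
/-- [cite: ImbrieJSP2016, eq. (1.3)] measurability of the window event. -/
theorem measurableSet_window {B : Set E} {Δ : E → ℝ} (hBm : MeasurableSet B) (hΔm : Measurable Δ)
    (y η : ℝ) : MeasurableSet (window B Δ y η) := by
  have : window B Δ y η = B ∩ Δ ⁻¹' Set.Ioc y (y + η) := by
    ext x
    simp only [window, Set.mem_setOf_eq, Set.mem_inter_iff, Set.mem_preimage, Set.mem_Ioc]
  rw [this]
  exact hBm.inter (hΔm measurableSet_Ioc)

/-- [cite: ImbrieJSP2016, eq. (1.1), (1.3) = (5.2)] THE SCALING LEMMA (pub-imbrie LLA.md WE10 (ii)):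
`μ {x ∈ B | y < Δ x ≤ y + η} ≤ (d η / (y + η)) · μ {x ∈ B | Δ x ≤ y + η}` for `y ≥ 0`, `η > 0`,
provided the sub-level set has finite measure. Proof: `(y/(y+η)) • S(y+η) ⊆ S(y)` is disjoint from the window,
both lie in `S(y+η)`, Haar scaling, and Bernoulli `1 - c^d ≤ d (1 - c)`. -/
theorem measure_window_le (μ : Measure E) [μ.IsAddHaarMeasure] {B : Set E} {Δ : E → ℝ}
    (hB : StarShapedAtZero B) (hBm : MeasurableSet B) (hΔ : PosHomogeneous Δ) (hΔm : Measurable Δ)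
    {y η : ℝ} (hy : 0 ≤ y) (hη : 0 < η) (hfin : μ (subLevel B Δ (y + η)) ≠ ∞) :
    μ (window B Δ y η)
      ≤ ENNReal.ofReal (Module.finrank ℝ E * η / (y + η)) * μ (subLevel B Δ (y + η)) := by
  set d := Module.finrank ℝ E with hd
  have hs : 0 < y + η := add_pos_of_nonneg_of_pos hy hη
  set S := subLevel B Δ (y + η) with hS_def
  set c := y / (y + η) with hc_def
  have hc0 : 0 ≤ c := div_nonneg hy hs.le
  have hsub : c • S ⊆ subLevel B Δ y := smul_subLevel_subset hB hΔ hy hs (by linarith)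
  have hWm : MeasurableSet (window B Δ y η) := measurableSet_window hBm hΔm y η
  have hdisj : Disjoint (window B Δ y η) (c • S) := by
    rw [Set.disjoint_left]
    intro x hx hx'
    have h1 : y < Δ x := hx.2.1
    have h2 : Δ x ≤ y := (hsub hx').2
    linarith
  have hWS : window B Δ y η ⊆ S := fun x hx => ⟨hx.1, hx.2.2⟩
  have hcS : c • S ⊆ S := fun x hx => ⟨(hsub hx).1, (hsub hx).2.trans (by linarith)⟩
  have hadd : μ (window B Δ y η) + μ (c • S) ≤ μ S := by
    rw [← measure_union' hdisj hWm]
    exact measure_mono (Set.union_subset hWS hcS)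
  have hscale : μ (c • S) = ENNReal.ofReal (c ^ d) * μ S := Measure.addHaar_smul_of_nonneg μ hc0 S
  rw [hscale] at hadd
  have hb : ENNReal.ofReal (c ^ d) * μ S ≠ ∞ := ENNReal.mul_ne_top ENNReal.ofReal_ne_top hfin
  have h1 : μ (window B Δ y η) ≤ μ S - ENNReal.ofReal (c ^ d) * μ S :=
    ENNReal.le_sub_of_add_le_right hb hadd
  have h2 : μ S - ENNReal.ofReal (c ^ d) * μ S = (1 - ENNReal.ofReal (c ^ d)) * μ S := by
    rw [ENNReal.sub_mul (fun _ _ => hfin), one_mul]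
  have hbern : 1 - c ^ d ≤ (d : ℝ) * η / (y + η) := by
    have h := one_add_le_pow_of_two_add_nonneg (show (0 : ℝ) ≤ 2 + (c - 1) by linarith) d
    have e1 : (1 : ℝ) + (c - 1) = c := by ring
    rw [e1] at h
    have hcs : 1 - c = η / (y + η) := by
      rw [hc_def]; field_simp; ring
    calc 1 - c ^ d ≤ (d : ℝ) * (1 - c) := by linarith
      _ = (d : ℝ) * η / (y + η) := by rw [hcs]; ring
  have h3 : (1 : ℝ≥0∞) - ENNReal.ofReal (c ^ d) ≤ ENNReal.ofReal ((d : ℝ) * η / (y + η)) := by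
    rw [← ENNReal.ofReal_one, ← ENNReal.ofReal_sub _ (pow_nonneg hc0 d)]
    exact ENNReal.ofReal_le_ofReal hbern
  calc μ (window B Δ y η) ≤ μ S - ENNReal.ofReal (c ^ d) * μ S := h1
    _ = (1 - ENNReal.ofReal (c ^ d)) * μ S := h2
    _ ≤ ENNReal.ofReal ((d : ℝ) * η / (y + η)) * μ S := by gcongr

/-- [cite: ImbrieJSP2016, eq. (1.1), (1.3) = (5.2)] SHIFT-0 LAW ⟹ ALL-SHIFTS LAW (pub-imbrie LLA.md WE10 (iii)):
if `μ {x ∈ B | Δ x ≤ t} ≤ A·t` for all `t > 0` with `A < ∞` (the linear small-gap law at shift `0`), then for every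
`y ≥ 0`, `η > 0`: `μ {x ∈ B | y < Δ x ≤ y + η} ≤ A · (d η)` — the same law at every shift, factor `d = dim E`. -/
theorem measure_window_le_of_shift_zero (μ : Measure E) [μ.IsAddHaarMeasure] {B : Set E} {Δ : E → ℝ}
    (hB : StarShapedAtZero B) (hBm : MeasurableSet B) (hΔ : PosHomogeneous Δ) (hΔm : Measurable Δ)
    {A : ℝ≥0∞} (hA : A ≠ ∞) (hlaw : ∀ t : ℝ, 0 < t → μ (subLevel B Δ t) ≤ A * ENNReal.ofReal t)
    {y η : ℝ} (hy : 0 ≤ y) (hη : 0 < η) :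
    μ (window B Δ y η) ≤ A * ENNReal.ofReal (Module.finrank ℝ E * η) := by
  have hs : 0 < y + η := add_pos_of_nonneg_of_pos hy hη
  have hS := hlaw (y + η) hs
  have hfin : μ (subLevel B Δ (y + η)) ≠ ∞ :=
    ne_top_of_le_ne_top (ENNReal.mul_ne_top hA ENNReal.ofReal_ne_top) hS
  have e : (y + η) * (Module.finrank ℝ E * η / (y + η)) = Module.finrank ℝ E * η := by
    field_simp
  calc μ (window B Δ y η)
      ≤ ENNReal.ofReal (Module.finrank ℝ E * η / (y + η)) * μ (subLevel B Δ (y + η)) :=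
        measure_window_le μ hB hBm hΔ hΔm hy hη hfin
    _ ≤ ENNReal.ofReal (Module.finrank ℝ E * η / (y + η)) * (A * ENNReal.ofReal (y + η)) := by
        gcongr
    _ = A * ENNReal.ofReal (Module.finrank ℝ E * η) := by
        rw [mul_comm, mul_assoc, ← ENNReal.ofReal_mul hs.le, e]

/-- [cite: ImbrieJSP2016, eq. (1.1), (1.3) = (5.2)] closed-window form of the scaling lemma (pub-imbrie LLA.md WE10 (iii)):
under the shift-0 law, `μ {x ∈ B | y ≤ Δ x ≤ y + η} ≤ A · (d η)` for all `y ≥ 0`, `η > 0` (`E` nontrivial, so `d ≥ 1`);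
obtained from the half-open form at shifts `y - 1/(n+1)` by continuity. -/
theorem measure_Icc_window_le_of_shift_zero [Nontrivial E] (μ : Measure E) [μ.IsAddHaarMeasure]
    {B : Set E} {Δ : E → ℝ}
    (hB : StarShapedAtZero B) (hBm : MeasurableSet B) (hΔ : PosHomogeneous Δ) (hΔm : Measurable Δ)
    {A : ℝ≥0∞} (hA : A ≠ ∞) (hlaw : ∀ t : ℝ, 0 < t → μ (subLevel B Δ t) ≤ A * ENNReal.ofReal t)
    {y η : ℝ} (hy : 0 ≤ y) (hη : 0 < η) :
    μ {x | x ∈ B ∧ y ≤ Δ x ∧ Δ x ≤ y + η} ≤ A * ENNReal.ofReal (Module.finrank ℝ E * η) := by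
  have hd : (1 : ℝ) ≤ Module.finrank ℝ E := by exact_mod_cast Module.finrank_pos
  rcases eq_or_lt_of_le hy with h0 | hpos
  · -- y = 0: the closed window lies in the sub-level set S η
    subst h0
    calc μ {x | x ∈ B ∧ (0 : ℝ) ≤ Δ x ∧ Δ x ≤ 0 + η} ≤ μ (subLevel B Δ η) :=
          measure_mono fun x hx => ⟨hx.1, by linarith [hx.2.2]⟩
      _ ≤ A * ENNReal.ofReal η := hlaw η hη
      _ ≤ A * ENNReal.ofReal (Module.finrank ℝ E * η) := by
          gcongr
          nlinarith
  · -- y > 0: approximate from the left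
    set W := {x | x ∈ B ∧ y ≤ Δ x ∧ Δ x ≤ y + η}
    have hlim : Tendsto (fun n : ℕ => A * ENNReal.ofReal (Module.finrank ℝ E * (η + 1 / ((n : ℝ) + 1))))
        atTop (𝓝 (A * ENNReal.ofReal (Module.finrank ℝ E * η))) := by
      have h0 : Tendsto (fun n : ℕ => 1 / ((n : ℝ) + 1)) atTop (𝓝 0) :=
        tendsto_one_div_add_atTop_nhds_zero_nat
      have h1 : Tendsto (fun n : ℕ => (Module.finrank ℝ E : ℝ) * (η + 1 / ((n : ℝ) + 1))) atTop
          (𝓝 ((Module.finrank ℝ E : ℝ) * (η + 0))) :=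
        (h0.const_add η).const_mul _
      rw [add_zero] at h1
      exact ENNReal.Tendsto.const_mul (ENNReal.tendsto_ofReal h1) (Or.inr hA)
    refine ge_of_tendsto hlim ?_
    have hev : ∀ᶠ n : ℕ in atTop, 1 / ((n : ℝ) + 1) < y :=
      (tendsto_order.1 (tendsto_one_div_add_atTop_nhds_zero_nat (𝕜 := ℝ))).2 y hpos
    filter_upwards [hev] with n hn
    set ε : ℝ := 1 / ((n : ℝ) + 1) with hε
    have hε0 : 0 < ε := by rw [hε]; positivity
    have hsubW : W ⊆ window B Δ (y - ε) (η + ε) := by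
      intro x hx
      refine ⟨hx.1, by linarith [hx.2.1], ?_⟩
      show Δ x ≤ y - ε + (η + ε)
      linarith [hx.2.2]
    calc μ W ≤ μ (window B Δ (y - ε) (η + ε)) := measure_mono hsubW
      _ ≤ A * ENNReal.ofReal (Module.finrank ℝ E * (η + ε)) :=
          measure_window_le_of_shift_zero μ hB hBm hΔ hΔm hA hlaw (by linarith) (by linarith)

omit [NormedAddCommGroup E] [NormedSpace ℝ E] [BorelSpace E] [FiniteDimensional ℝ E] in
/-- [cite: ImbrieJSP2016, p. 1000 (bounded densities), eq. (1.3)] TRANSFER TO A LAW WITH BOUNDED DENSITY: if `P ≤ D • μ`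
(e.g. the joint law of the couplings, cf. `boxMeasure_le_smul_volume`) and the window has `μ`-measure `≤ M`, then
`P (window) ≤ D * M`. Combine with `measure_window_le_of_shift_zero`. -/
theorem measure_window_le_of_le_smul {μ P : Measure E} {D : ℝ≥0∞} (hP : P ≤ D • μ) {B : Set E} {Δ : E → ℝ}
    {y η : ℝ} {M : ℝ≥0∞} (hM : μ (window B Δ y η) ≤ M) :
    P (window B Δ y η) ≤ D * M :=
  calc P (window B Δ y η) ≤ (D • μ) (window B Δ y η) := Measure.le_iff'.1 hP _
    _ = D * μ (window B Δ y η) := by rw [Measure.smul_apply, smul_eq_mul]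
    _ ≤ D * M := by gcongr

end Literature.MathematicalPhysics.QuantumLattice.Imbrie2016
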